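import Summits.BirchSwinnertonDyer.Rank1Residual.GaloisImage.KolyvaginLedgerAlgebra
import Literature.NumberTheory.EllipticCurves.KummerSelmerStructure
import Literature.NumberTheory.EllipticCurves.SelmerGroupCardinality
import Literature.NumberTheory.EllipticCurves.BSDSelmerProofs
import Literature.NumberTheory.EllipticCurves.MazurTorsionGaloisStructureProofs
import HarnessLib

/-!
# Selmer-to-Ш bookkeeping for the (a′) assembly: in analytic rank `0` with `E[p]` irreducible,
# `#Sel_{p^K}(E/ℚ) ∣ #Ш(E/ℚ)[p^∞]` and `#Ш(E/ℚ)[p^∞]` kills `Sel_{p^K}(E/ℚ)`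
# (team n1011, ROUTE-1 sub-target R1-23, skeleton `cells/n1011/skel/T-R1-23.md` step S6; p18)

HONEST FRAMING (cell `b2b-bsdres`, run/shared/lean/b2b/bsd-rank1-residual/, verbatim in every
file): the goal of the cell is to DELETE the COMBINATION-SHAPED residual classes of the
Birch–Swinnerton-Dyer formula for ALL analytic-rank `≤ 1` elliptic curves over `ℚ` — "full BSD
formula for every rank `≤ 1` curve in class `C`" assembled STRICTLY from published theorems — so
that the rank-`≤ 1` remainder becomes exactly the CONSTRUCTION-SHAPED classes, which are TYPED
(missing-input `Prop`s), NOT attempted. This is not "finishing BSD". Team n1011 (N10/N11, the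
additive block `X4 ∧ p = 3`): research route; TOOL theorems, no class theorem, nothing booked, no
mark changed, no fact.

## What and why

The assembly `KuriharaLowerBoundAssembly` outputs `p^{v+1−j} ∣ #H¹_𝓚(ℚ, E[p^K])` (the classical
`p^K`-Selmer group, `selmerGroup_eq_selmerGroup_kummerSelmerStructure`) and consumes the exponent
`hX : p^X · H¹_𝓚 = 0`.  For a curve with FINITE Mordell–Weil group (analytic rank `0`) and `E[p]`
irreducible (no rational point of order `p`, `not_hasIrreducibleModPGaloisRep_of_addOrderOf_eq`),
the Kummer sequence `0 → E(ℚ)/p^K → Sel_{p^K} → Ш[p^K] → 0` (`selmer_exact_holds`) has trivial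
first term, so `Sel_{p^K} ≅ Ш[p^K] ↪ Ш[p^∞]`: `natCard_selmerGroup_kummer_dvd_card_primaryComponent`
(`#Sel_{p^K} ∣ #Ш[p^∞]`) and `card_primaryComponent_nsmul_selmerGroup_kummer` (`#Ш[p^∞] · s = 0`),
at the modulus `p^k · p` of the propagated structure.

References: J. H. Silverman, *AEC* X.4.2 [SilvermanAEC2009]; B. Mazur, *Modular curves and the
Eisenstein ideal* (1977) III §5 [Mazur1977].
-/

noncomputable section

namespace Summit.BirchSwinnertonDyer.Rank1Residual.GaloisImage.SelmerSha

open WeierstrassCurve Literature.NumberTheory.EllipticCurves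

variable (W : WeierstrassCurve ℚ) [W.IsElliptic] (p : ℕ) [hp : Fact p.Prime]

/-- No rational point is killed by a power of `p` when `E[p]` is irreducible (a point of order
`p^i`, `i ≥ 1`, yields one of order `p`, Mazur III §5). [cite: Mazur1977, Ch. III §5, p. 157] -/
theorem eq_zero_of_pow_smul_eq_zero (hirr : W.HasIrreducibleModPGaloisRep p) (K : ℕ)
    (P : W.toAffine.Point) (hP : p ^ K • P = 0) : P = 0 := by
  obtain ⟨i, hiK, hi⟩ := (Nat.dvd_prime_pow hp.out).1 (addOrderOf_dvd_of_nsmul_eq_zero hP)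
  rcases Nat.eq_zero_or_pos i with h0 | hpos
  · rw [h0, pow_zero] at hi
    exact AddMonoid.addOrderOf_eq_one_iff.1 hi
  · exfalso
    have hord : addOrderOf (p ^ (i - 1) • P) = p := by
      have h := Ledger.addOrderOf_pow_nsmul_of_addOrderOf_eq (p := p) P (K₀ := 1) (r := i - 1)
        Nat.one_pos (by rw [hi]; congr 1; omega)
      rwa [pow_one] at h
    exact not_hasIrreducibleModPGaloisRep_of_addOrderOf_eq W hord hirr

/-- Every rational point is a `p^K`-multiple when `E(ℚ)` is finite and `E[p]` irreducible
(multiplication by `p^K` is injective, hence onto). [cite: SilvermanAEC2009, X.4.2] -/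
theorem zsmul_pow_surjective [Finite W.toAffine.Point] (hirr : W.HasIrreducibleModPGaloisRep p)
    (K : ℕ) : Function.Surjective (fun P : W.toAffine.Point => ((p ^ K : ℕ) : ℤ) • P) := by
  apply Finite.surjective_of_injective
  intro P Q h
  have h2 : ((p ^ K : ℕ) : ℤ) • P = ((p ^ K : ℕ) : ℤ) • Q := h
  have h' : p ^ K • (P - Q) = 0 := by rw [← natCast_zsmul, zsmul_sub, h2, sub_self]
  exact sub_eq_zero.1 (eq_zero_of_pow_smul_eq_zero W p hirr K _ h')

/-- `E(ℚ)[p^K] = 0` when `E[p]` is irreducible. [cite: Mazur1977, Ch. III §5, p. 157] -/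
theorem torsionBy_point_eq_bot (hirr : W.HasIrreducibleModPGaloisRep p) (K : ℕ) :
    AddSubgroup.torsionBy W.toAffine.Point (((p ^ K : ℕ) : ℤ)) = ⊥ := by
  rw [eq_bot_iff]
  intro P hP
  rw [AddSubgroup.mem_bot]
  exact eq_zero_of_pow_smul_eq_zero W p hirr K P (AddSubgroup.torsionBy.nsmul_iff.1 hP)

/-- **`Sel_n(E/ℚ) ≅ Ш(E/ℚ)[n]` in rank `0` with `E[p]` irreducible, `n = p^K`, as two facts about
the map `H¹(ℚ, E[n]) → H¹(ℚ, E)`**: it is injective on the Selmer group and maps it onto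
`Ш ∩ H¹[n]` (the Kummer term `E(ℚ)/nE(ℚ)` has order `#E(ℚ)[n] = 1`, so the count
`#Sel_n = #(E(ℚ)/n) · #(Ш ∩ H¹[n])` forces injectivity). [cite: SilvermanAEC2009, Thm. X.4.2 (a)] -/
theorem selmer_injOn_and_map_eq [Finite W.toAffine.Point] [Finite W.sha]
    (hirr : W.HasIrreducibleModPGaloisRep p) (K : ℕ) :
    (∀ c ∈ W.selmerGroup (((p ^ K : ℕ) : ℤ)), W.torsionH1ToH1 (((p ^ K : ℕ) : ℤ)) c = 0 → c = 0) ∧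
      (W.selmerGroup (((p ^ K : ℕ) : ℤ))).map (W.torsionH1ToH1 (((p ^ K : ℕ) : ℤ))) =
        W.sha ⊓ AddSubgroup.torsionBy W.galH1 (((p ^ K : ℕ) : ℤ)) := by
  have hn0 : (p ^ K : ℕ) ≠ 0 := pow_ne_zero K hp.out.ne_zero
  have hn : (((p ^ K : ℕ) : ℤ)) ≠ 0 := by exact_mod_cast hn0
  obtain ⟨-, -, -, hmap⟩ := selmer_exact_holds W _ hn
  refine ⟨?_, hmap⟩
  -- the count: `#Sel_n = #(E(ℚ)/n) · #(Ш ∩ H¹[n])` with `#(E(ℚ)/n) = #E(ℚ)[n] = 1`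
  have hcard : Nat.card (W.selmerGroup (((p ^ K : ℕ) : ℤ))) =
      Nat.card (W.sha ⊓ AddSubgroup.torsionBy W.galH1 (((p ^ K : ℕ) : ℤ)) : AddSubgroup W.galH1) := by
    have key := card_selmerGroup_eq_card_quotient_mul_card_sha W (p ^ K) hn0
    have hq : Nat.card (W.toAffine.Point ⧸
        (zsmulAddGroupHom (α := W.toAffine.Point) (((p ^ K : ℕ) : ℤ))).range) = 1 := by
      rw [natCard_quotient_range_zsmul_eq_natCard_torsionBy_of_finite, torsionBy_point_eq_bot W p hirr K,
        AddSubgroup.card_bot]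
    -- transport the computable `DecidableEq ℚ` of this file's statements to the classical one of
    -- the number-field lemma (tree idiom, `X11b/Three/NineDescentCertificate.lean`)
    have hinst : (instDecidableEqRat : DecidableEq ℚ) = fun a b => Classical.propDecidable (a = b) :=
      Subsingleton.elim _ _
    rw [hinst] at hq
    rw [hq, one_mul] at key
    exact key
  haveI : Finite (W.sha ⊓ AddSubgroup.torsionBy W.galH1 (((p ^ K : ℕ) : ℤ)) : AddSubgroup W.galH1) :=
    Finite.of_injective (fun x => (⟨x.1, x.2.1⟩ : W.sha))
      (fun x y h => Subtype.ext (by simpa using congrArg Subtype.val h))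
  -- the restricted map is onto `Ш ∩ H¹[n]`, hence (equal finite cardinalities) injective
  set T := W.torsionH1ToH1 (((p ^ K : ℕ) : ℤ)) with hT
  let ψ : W.selmerGroup (((p ^ K : ℕ) : ℤ)) →
      (W.sha ⊓ AddSubgroup.torsionBy W.galH1 (((p ^ K : ℕ) : ℤ)) : AddSubgroup W.galH1) :=
    fun c => ⟨T c.1, by rw [← hmap]; exact ⟨c.1, c.2, rfl⟩⟩
  have hsurj : Function.Surjective ψ := by
    intro y
    have hy : (y : W.galH1) ∈ (W.selmerGroup (((p ^ K : ℕ) : ℤ))).map T := by rw [hmap]; exact y.2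
    obtain ⟨c, hc, hcy⟩ := hy
    exact ⟨⟨c, hc⟩, Subtype.ext hcy⟩
  haveI : Finite (W.selmerGroup (((p ^ K : ℕ) : ℤ))) := by
    refine Nat.finite_of_card_ne_zero ?_
    rw [hcard]
    exact Nat.card_pos.ne'
  haveI : Fintype (W.selmerGroup (((p ^ K : ℕ) : ℤ))) := Fintype.ofFinite _
  haveI : Fintype (W.sha ⊓ AddSubgroup.torsionBy W.galH1 (((p ^ K : ℕ) : ℤ)) : AddSubgroup W.galH1) :=
    Fintype.ofFinite _
  obtain ⟨e⟩ : Nonempty (W.selmerGroup (((p ^ K : ℕ) : ℤ)) ≃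
      (W.sha ⊓ AddSubgroup.torsionBy W.galH1 (((p ^ K : ℕ) : ℤ)) : AddSubgroup W.galH1)) := by
    rw [← Fintype.card_eq, ← Nat.card_eq_fintype_card, ← Nat.card_eq_fintype_card, hcard]
  have hinj : Function.Injective ψ := (Finite.injective_iff_surjective_of_equiv e).2 hsurj
  intro c hc h0
  have h := @hinj ⟨c, hc⟩ ⟨0, zero_mem _⟩ (Subtype.ext (by show T c = T 0; rw [h0, map_zero]))
  simpa using congrArg Subtype.val h

/-- **`#Sel_{p^K}(E/ℚ) ∣ #Ш(E/ℚ)[p^∞]` and `#Ш(E/ℚ)[p^∞]` kills `Sel_{p^K}(E/ℚ)`** (rank `0`,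
`E[p]` irreducible, `Ш` finite), for the classical Selmer structure at the modulus `p^k · p` of the
propagated structure. [cite: SilvermanAEC2009, Thm. X.4.2 (a)] -/
theorem card_dvd_and_nsmul_eq_zero [Finite W.toAffine.Point] [Finite W.sha]
    (hirr : W.HasIrreducibleModPGaloisRep p) (k : ℕ) :
    Nat.card (W.kummerSelmerStructure ((p : ℤ) ^ k * (p : ℤ))).selmerGroup ∣
        Nat.card (AddCommGroup.primaryComponent W.sha p) ∧
      ∀ s ∈ (W.kummerSelmerStructure ((p : ℤ) ^ k * (p : ℤ))).selmerGroup,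
        Nat.card (AddCommGroup.primaryComponent W.sha p) • s = 0 := by
  -- reduce to the modulus `((p^(k+1) : ℕ) : ℤ)`
  suffices key : ∀ m : ℤ, m = ((p ^ (k + 1) : ℕ) : ℤ) →
      (Nat.card (W.kummerSelmerStructure m).selmerGroup ∣
          Nat.card (AddCommGroup.primaryComponent W.sha p) ∧
        ∀ s ∈ (W.kummerSelmerStructure m).selmerGroup,
          Nat.card (AddCommGroup.primaryComponent W.sha p) • s = 0) from
    key _ (by push_cast; ring)
  intro m hm
  subst hm
  set n : ℤ := ((p ^ (k + 1) : ℕ) : ℤ) with hn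
  obtain ⟨hinj, hmap⟩ := selmer_injOn_and_map_eq W p hirr (k + 1)
  rw [← selmerGroup_eq_selmerGroup_kummerSelmerStructure]
  -- the image `Ш ∩ H¹[n]` sits inside `Ш[p^∞]`
  set T := W.torsionH1ToH1 n with hT
  have himage : ∀ c ∈ W.selmerGroup n, ∃ hc : T c ∈ W.sha,
      (⟨T c, hc⟩ : W.sha) ∈ AddCommGroup.primaryComponent W.sha p := by
    intro c hc
    have h : T c ∈ (W.selmerGroup n).map T := ⟨c, hc, rfl⟩
    rw [hmap] at h
    refine ⟨h.1, ?_⟩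
    rw [AddCommGroup.mem_primaryComponent]
    refine ⟨k + 1, Subtype.ext ?_⟩
    simpa using AddSubgroup.torsionBy.nsmul_iff.1 h.2
  -- the restricted map `Sel_n → Ш[p^∞]` as an injective homomorphism
  let φ : W.selmerGroup n →+ AddCommGroup.primaryComponent W.sha p :=
    { toFun := fun c => ⟨⟨T c.1, (himage c.1 c.2).1⟩, (himage c.1 c.2).2⟩
      map_zero' := by ext; simp
      map_add' := fun x y => by ext; simp }
  have hφ : Function.Injective φ := by
    intro x y h
    have h' : T x.1 = T y.1 := by
      simpa [φ] using congrArg (fun z : AddCommGroup.primaryComponent W.sha p => (z.1 : W.galH1)) h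
    have h0 : T (x.1 - y.1) = 0 := by rw [map_sub, h', sub_self]
    exact Subtype.ext (sub_eq_zero.1 (hinj _ (sub_mem x.2 y.2) h0))
  refine ⟨?_, fun s hs => ?_⟩
  · exact (dvd_of_eq (Nat.card_congr (AddMonoidHom.ofInjective hφ).toEquiv)).trans
      (AddSubgroup.card_addSubgroup_dvd_card φ.range)
  · have h1 : Nat.card (AddCommGroup.primaryComponent W.sha p) • φ ⟨s, hs⟩ = 0 :=
      addOrderOf_dvd_iff_nsmul_eq_zero.1 (addOrderOf_dvd_natCard _)
    rw [← map_nsmul] at h1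
    have h2 : (Nat.card (AddCommGroup.primaryComponent W.sha p) • (⟨s, hs⟩ : W.selmerGroup n)) = 0 :=
      hφ (by rw [h1, map_zero])
    have h3 := congrArg Subtype.val h2
    rw [AddSubgroupClass.coe_nsmul, ZeroMemClass.coe_zero] at h3
    exact h3

end Summit.BirchSwinnertonDyer.Rank1Residual.GaloisImage.SelmerSha

end
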